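import Summits.CriticalPhenomena.PercolationContinuityZ3.Theorems.PercNearOneGluingNoHeavyLowerTailOneLayerLemmas
import Literature.Probability.Percolation.KozmaNitzanPreFKG
import HarnessLib

/-!
# `NoHeavyLowerTail` (stmt-CriticalPhenomena-4575) — star-integration kit for one-layer observers

Support lemmas (route `PercNearOneGluingNoHeavy`, crux `NoHeavyLowerTail`, registered stub
`stub_sourceRepellerExchangeThreeRelays` = (Y13) of `preFKG3_of_stubSourceRepellerExchange`) for integrating out an
observer vertex `o` à la Kozma–Nitzan (arXiv:2401.12397, Lemma 5 / proof of Thm. 4): on the star event `σ_B`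
(`KNPreFKG.starEvent`) reachability between vertices `≠ o` is reachability off `o`, possibly glued through the open
hairs (`th_reach_iff_off`, `th_reach_o_iff`, `th_reach_iff_pair` and the membership "kit" `th_kit_*`); a measure
sliced along `σ_B` factorises into the star weight times a measure of the graph with `o` deleted
(`th_real_inter_star`, via `KNPreFKG.real_starEvent_inter_preimage` and the restriction coupling); and the two-hair
decomposition `μ(E) = Σ_{B ⊆ {a₁,a₂}} μ(E ∩ σ_B)` (`th_real_eq_four`).  Also the BHK exchange row
`th_L1_general` / `th_Z0_nonneg` for an arbitrary finite vertex type (needed on `{o}ᶜ`).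
Used by `PercNearOneGluingNoHeavyLowerTailTwoHairExchange`.
-/

namespace Summit.CriticalPhenomena.PercolationContinuityZ3.Theorems

open MeasureTheory Set Literature.Probability.LatticeModels Literature.Probability.Percolation
open Literature.Probability.Percolation.KNPreFKG

noncomputable section

open Classical

section StarConn

variable {V : Type*}

/-- Under `σ_B` with `B` containing at most one vertex, an open path between two vertices `≠ o` may be taken off `o`
(a visit to `o` enters and leaves through the same vertex of `B`). [cite: KozmaNitzan2024, Lemma 5 (p. 13)] -/
theorem th_reach_iff_off {ω : BondConfig V} {o : V} {B : Set V} (hσ : ω ∈ starEvent o B)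
    (hB : ∀ u ∈ B, ∀ u' ∈ B, u = u') {x y : V} (hx : x ≠ o) (hy : y ≠ o) :
    (openGraph ω).Reachable x y ↔ ω ∈ openConnIn {o}ᶜ x y := by
  constructor
  · rintro ⟨p⟩
    rcases (walk_decomp hσ p hy).1 hx with h | ⟨⟨u, huB, _, hxu⟩, ⟨u', hu'B, _, hu'y⟩⟩
    · exact h
    · rw [hB u huB u' hu'B] at hxu
      exact openConnIn_trans hxu hu'y
  · exact reachable_of_openConnIn

/-- Under `σ_B`, `o` is joined to `y ≠ o` iff some vertex of `B` (other than `o`) is joined to `y` off `o`.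
[cite: KozmaNitzan2024, Lemma 5 (p. 13)] -/
theorem th_reach_o_iff {ω : BondConfig V} {o : V} {B : Set V} (hσ : ω ∈ starEvent o B) {y : V} (hy : y ≠ o) :
    (openGraph ω).Reachable o y ↔ ∃ u ∈ B, u ≠ o ∧ ω ∈ openConnIn {o}ᶜ u y := by
  constructor
  · rintro ⟨p⟩
    exact (walk_decomp hσ p hy).2 rfl
  · rintro ⟨u, huB, huo, huy⟩
    have hou : s(o, u) ∈ ω := ((mem_starEvent_iff o B ω).1 hσ u huo).2 huB
    have hadj : (openGraph ω).Adj o u := (openGraph_adj ω o u).2 ⟨hou, huo.symm⟩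
    exact hadj.reachable.trans (reachable_of_openConnIn huy)

/-- Under `σ_{{u,v}}` (both hairs open), two vertices `≠ o` are joined iff they are joined off `o`, or each is joined off `o`
to one of `u, v` (the star glues `u` and `v`). [cite: KozmaNitzan2024, Lemma 5 (p. 13)] -/
theorem th_reach_iff_pair {ω : BondConfig V} {o u v : V} (hσ : ω ∈ starEvent o ({u, v} : Set V))
    (huo : u ≠ o) (hvo : v ≠ o) {x y : V} (hx : x ≠ o) (hy : y ≠ o) :
    (openGraph ω).Reachable x y ↔
      ω ∈ openConnIn {o}ᶜ x y ∨
        ((ω ∈ openConnIn {o}ᶜ x u ∨ ω ∈ openConnIn {o}ᶜ x v) ∧ (ω ∈ openConnIn {o}ᶜ u y ∨ ω ∈ openConnIn {o}ᶜ v y)) := by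
  constructor
  · rintro ⟨p⟩
    rcases (walk_decomp hσ p hy).1 hx with h | ⟨⟨u₁, hu₁B, _, hxu⟩, ⟨u₂, hu₂B, _, hu'y⟩⟩
    · exact Or.inl h
    · right
      refine ⟨?_, ?_⟩
      · rcases hu₁B with rfl | rfl
        · exact Or.inl hxu
        · exact Or.inr hxu
      · rcases hu₂B with rfl | rfl
        · exact Or.inl hu'y
        · exact Or.inr hu'y
  · rintro (h | ⟨h1, h2⟩)
    · exact reachable_of_openConnIn h
    · -- x ~ u_i off o, u_i — o — u_j (both hairs open), u_j ~ y off o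
      have hadj : ∀ z ∈ ({u, v} : Set V), z ≠ o → (openGraph ω).Reachable o z := by
        intro z hz hzo
        have hoz : s(o, z) ∈ ω := ((mem_starEvent_iff o _ ω).1 hσ z hzo).2 hz
        exact ((openGraph_adj ω o z).2 ⟨hoz, hzo.symm⟩).reachable
      have h1' : (openGraph ω).Reachable x o := by
        rcases h1 with h | h
        · exact (reachable_of_openConnIn h).trans (hadj u (by simp) huo).symm
        · exact (reachable_of_openConnIn h).trans (hadj v (by simp) hvo).symm
      have h2' : (openGraph ω).Reachable o y := by
        rcases h2 with h | h
        · exact (hadj u (by simp) huo).trans (reachable_of_openConnIn h)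
        · exact (hadj v (by simp) hvo).trans (reachable_of_openConnIn h)
      exact h1'.trans h2'

end StarConn

section GeneralL1

variable {V : Type*} [Fintype V]

/-- **L1 for an arbitrary finite vertex type** (the repeller swallowing the second source):
`μ(R ∩ {a₃↔a₂} ∩ {a₁↔b})·μ(R ∩ {a₃↔b}) ≤ μ(R ∩ {a₃↔a₂} ∩ {a₃↔b})·μ(R ∩ {a₁↔b})`, `R = {a₁↮a₃}`
(BHK Thm 1.3 for `C(a₃)` given `a₃ ↮ a₁` times Thm 1.4 across `C(a₁), C(a₃)`, common factor cancelled; cf. `oll_repellerSwallow` on `Fin n`).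
[cite: VandenbergHaggstromKahn2005, Thms. 1.3–1.5 (pp. 6–7)] -/
theorem th_L1_general (w : Sym2 V → unitInterval) (b a₁ a₂ a₃ : V) (h13 : a₁ ≠ a₃) :
    (prodBernoulli w).real ((openConn a₁ a₃)ᶜ ∩ (openConn a₃ a₂ ∩ openConn a₁ b)) *
        (prodBernoulli w).real ((openConn a₁ a₃)ᶜ ∩ openConn a₃ b) ≤
      (prodBernoulli w).real ((openConn a₁ a₃)ᶜ ∩ (openConn a₃ a₂ ∩ openConn a₃ b)) *
        (prodBernoulli w).real ((openConn a₁ a₃)ᶜ ∩ openConn a₁ b) := by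
  classical
  -- (a) CPA of C(a₃) given a₃ ↮ a₁
  have hA := bhk_one_upper_upper w a₃ ({a₁} : Set V) (by simpa using fun h => h13 h.symm)
    (isUpperSet_connFamily a₃ a₂) (isUpperSet_connFamily a₃ b)
  have hsep : {ω : BondConfig V | ∀ x ∈ ({a₁} : Set V), ¬ (openGraph ω).Reachable a₃ x} = (openConn a₃ a₁)ᶜ := by
    ext ω
    simp only [Set.mem_singleton_iff, forall_eq, Set.mem_setOf_eq, Set.mem_compl_iff]
    rfl
  rw [hsep, ← openConn_eq_setOf_connFamily, ← openConn_eq_setOf_connFamily, openConn_symm a₃ a₁] at hA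
  -- (b) BHK 1.4 across C(a₁), C(a₃)
  have hB := bhk_two_upper_upper w a₁ a₃ h13 (isUpperSet_connFamily a₁ b) (isUpperSet_connFamily a₃ a₂)
  rw [← openConn_eq_setOf_connFamily, ← openConn_eq_setOf_connFamily] at hB
  have hRset : ({ω : BondConfig V | ¬ (openGraph ω).Reachable a₁ a₃}) = (openConn a₁ a₃)ᶜ := rfl
  rw [hRset] at hB
  set μR := (prodBernoulli w).real ((openConn a₁ a₃)ᶜ : Set (BondConfig V)) with hμR
  set Zp := (prodBernoulli w).real ((openConn a₁ a₃)ᶜ ∩ openConn a₃ a₂) with hZp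
  set Tm := (prodBernoulli w).real ((openConn a₁ a₃)ᶜ ∩ openConn a₃ b) with hTm
  set Bm := (prodBernoulli w).real ((openConn a₁ a₃)ᶜ ∩ openConn a₁ b) with hBm
  set ZT := (prodBernoulli w).real ((openConn a₁ a₃)ᶜ ∩ (openConn a₃ a₂ ∩ openConn a₃ b)) with hZT
  set ZB := (prodBernoulli w).real ((openConn a₁ a₃)ᶜ ∩ (openConn a₃ a₂ ∩ openConn a₁ b)) with hZB
  have eZB : (prodBernoulli w).real ((openConn a₁ a₃)ᶜ ∩ (openConn a₁ b ∩ openConn a₃ a₂)) = ZB := by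
    rw [hZB, Set.inter_comm (openConn a₁ b : Set (BondConfig V))]
  rw [eZB] at hB
  have h0R : 0 ≤ μR := measureReal_nonneg
  have h0Z : 0 ≤ Zp := measureReal_nonneg
  have h0T : 0 ≤ Tm := measureReal_nonneg
  have h0B : 0 ≤ Bm := measureReal_nonneg
  have h0ZT : 0 ≤ ZT := measureReal_nonneg
  have h0ZB : 0 ≤ ZB := measureReal_nonneg
  have hprod : (μR * Zp) * (ZB * Tm) ≤ (μR * Zp) * (ZT * Bm) := by
    have := mul_le_mul hB hA (mul_nonneg h0Z h0T) (mul_nonneg h0B h0Z)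
    nlinarith [this]
  refine oll_cancel (mul_nonneg h0R h0Z) (mul_nonneg h0ZT h0B) hprod fun hz => ?_
  have hZB_le : ZB ≤ Zp := measureReal_mono (Set.inter_subset_inter_right _ Set.inter_subset_left)
  have hZp_le : Zp ≤ μR := measureReal_mono Set.inter_subset_left
  rcases mul_eq_zero.1 hz with h | h
  · have : Zp = 0 := le_antisymm (h ▸ hZp_le) h0Z
    exact mul_eq_zero_of_left (le_antisymm (this ▸ hZB_le) h0ZB) _
  · exact mul_eq_zero_of_left (le_antisymm (h ▸ hZB_le) h0ZB) _

/-- **`Z₀ ≥ 0`** (the quantity in the two-hair identity): with `R = {a₁↮a₃}`, `N₁₂ = R ∩ {a₃↮a₂}`,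
`μ(N₁₂ ∩ ({a₁↔b} ∪ {a₂↔b}))·μ(R ∩ {a₃↔b}) ≥ μ(N₁₂ ∩ {a₃↔b})·μ(R ∩ {a₁↔b})`.  From `th_L1_general` and
`{a₁↔b} ∪ {a₂↔b} ⊇ {a₁↔b}`. [cite: VandenbergHaggstromKahn2005, Thm. 1.5 (p. 7)] -/
theorem th_Z0_nonneg (w : Sym2 V → unitInterval) (b a₁ a₂ a₃ : V) (h13 : a₁ ≠ a₃) :
    (prodBernoulli w).real ((openConn a₁ a₃)ᶜ ∩ (openConn a₃ a₂)ᶜ ∩ openConn a₃ b) *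
        (prodBernoulli w).real ((openConn a₁ a₃)ᶜ ∩ openConn a₁ b) ≤
      (prodBernoulli w).real ((openConn a₁ a₃)ᶜ ∩ (openConn a₃ a₂)ᶜ ∩ (openConn a₁ b ∪ openConn a₂ b)) *
        (prodBernoulli w).real ((openConn a₁ a₃)ᶜ ∩ openConn a₃ b) := by
  have hm : ∀ s : Set (BondConfig V), MeasurableSet s := fun _ => MeasurableSet.of_discrete
  have hL := th_L1_general w b a₁ a₂ a₃ h13
  -- μ(N₁₂ ∩ X) = μ(R ∩ X) − μ(R ∩ Z' ∩ X)
  have hsT := measureReal_inter_add_sdiff (μ := prodBernoulli w)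
    (s := ((openConn a₁ a₃)ᶜ ∩ openConn a₃ b : Set (BondConfig V))) (hm (openConn a₃ a₂))
  have hsB := measureReal_inter_add_sdiff (μ := prodBernoulli w)
    (s := ((openConn a₁ a₃)ᶜ ∩ openConn a₁ b : Set (BondConfig V))) (hm (openConn a₃ a₂))
  have e1 : (((openConn a₁ a₃)ᶜ ∩ openConn a₃ b) ∩ openConn a₃ a₂ : Set (BondConfig V)) =
      (openConn a₁ a₃)ᶜ ∩ (openConn a₃ a₂ ∩ openConn a₃ b) := by
    ext ω; simp only [Set.mem_inter_iff, Set.mem_compl_iff]; tauto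
  have e2 : (((openConn a₁ a₃)ᶜ ∩ openConn a₃ b) \ openConn a₃ a₂ : Set (BondConfig V)) =
      (openConn a₁ a₃)ᶜ ∩ (openConn a₃ a₂)ᶜ ∩ openConn a₃ b := by
    ext ω; simp only [Set.mem_sdiff, Set.mem_inter_iff, Set.mem_compl_iff]; tauto
  have e3 : (((openConn a₁ a₃)ᶜ ∩ openConn a₁ b) ∩ openConn a₃ a₂ : Set (BondConfig V)) =
      (openConn a₁ a₃)ᶜ ∩ (openConn a₃ a₂ ∩ openConn a₁ b) := by
    ext ω; simp only [Set.mem_inter_iff, Set.mem_compl_iff]; tauto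
  have e4 : (((openConn a₁ a₃)ᶜ ∩ openConn a₁ b) \ openConn a₃ a₂ : Set (BondConfig V)) =
      (openConn a₁ a₃)ᶜ ∩ (openConn a₃ a₂)ᶜ ∩ openConn a₁ b := by
    ext ω; simp only [Set.mem_sdiff, Set.mem_inter_iff, Set.mem_compl_iff]; tauto
  rw [e1, e2] at hsT
  rw [e3, e4] at hsB
  -- monotonicity B ⊆ B ∪ B₂ inside N₁₂
  have hmono : (prodBernoulli w).real ((openConn a₁ a₃)ᶜ ∩ (openConn a₃ a₂)ᶜ ∩ openConn a₁ b) ≤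
      (prodBernoulli w).real ((openConn a₁ a₃)ᶜ ∩ (openConn a₃ a₂)ᶜ ∩ (openConn a₁ b ∪ openConn a₂ b)) :=
    measureReal_mono (Set.inter_subset_inter_right _ Set.subset_union_left)
  have h0T : 0 ≤ (prodBernoulli w).real ((openConn a₁ a₃)ᶜ ∩ openConn a₃ b) := measureReal_nonneg
  have hm' := mul_le_mul_of_nonneg_right hmono h0T
  linear_combination hL + hm' + (prodBernoulli w).real ((openConn a₁ a₃)ᶜ ∩ openConn a₁ b) * hsT -
    (prodBernoulli w).real ((openConn a₁ a₃)ᶜ ∩ openConn a₃ b) * hsB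

end GeneralL1

section StarKit

variable {V : Type*}

/-- Symmetry of `{x ↔ y in S}` (membership form). [folklore] -/
theorem th_off_comm (S : Set V) (x y : V) (ω : BondConfig V) : ω ∈ openConnIn S x y ↔ ω ∈ openConnIn S y x :=
  ⟨fun ⟨hx, hy, h⟩ => ⟨hy, hx, h.symm⟩, fun ⟨hy, hx, h⟩ => ⟨hx, hy, h.symm⟩⟩

/-- `x ↔ x` off `o` for `x ≠ o`. [folklore] -/
theorem th_off_rfl {o x : V} (hx : x ≠ o) (ω : BondConfig V) : ω ∈ openConnIn {o}ᶜ x x :=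
  openConnIn_rfl (show x ∈ ({o}ᶜ : Set V) from hx) ω

/-- Under `σ_∅`: two vertices `≠ o` are joined iff joined off `o`. [cite: KozmaNitzan2024, Lemma 5 (p. 13)] -/
theorem th_kit_empty {ω : BondConfig V} {o : V} (hσ : ω ∈ starEvent o (∅ : Set V)) {x y : V} (hx : x ≠ o) (hy : y ≠ o) :
    ω ∈ openConn x y ↔ ω ∈ openConnIn {o}ᶜ x y :=
  th_reach_iff_off hσ (fun u hu => absurd hu (Set.notMem_empty u)) hx hy

/-- Under `σ_∅`: `o` is isolated. [cite: KozmaNitzan2024, Lemma 5 (p. 13)] -/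
theorem th_kit_empty_o {ω : BondConfig V} {o : V} (hσ : ω ∈ starEvent o (∅ : Set V)) {y : V} (hy : y ≠ o) :
    ω ∉ openConn y o := by
  intro h
  obtain ⟨u, hu, -⟩ := (th_reach_o_iff hσ hy).1 (SimpleGraph.Reachable.symm h)
  exact absurd hu (Set.notMem_empty u)

/-- Under `σ_{u}`: two vertices `≠ o` are joined iff joined off `o`. [cite: KozmaNitzan2024, Lemma 5 (p. 13)] -/
theorem th_kit_single {ω : BondConfig V} {o u : V} (hσ : ω ∈ starEvent o ({u} : Set V)) {x y : V} (hx : x ≠ o)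
    (hy : y ≠ o) : ω ∈ openConn x y ↔ ω ∈ openConnIn {o}ᶜ x y :=
  th_reach_iff_off hσ (fun a ha a' ha' => by rw [Set.mem_singleton_iff.1 ha, Set.mem_singleton_iff.1 ha']) hx hy

/-- Under `σ_{u}` (`u ≠ o`): `y ↔ o` iff `u ↔ y` off `o`. [cite: KozmaNitzan2024, Lemma 5 (p. 13)] -/
theorem th_kit_single_o {ω : BondConfig V} {o u : V} (hσ : ω ∈ starEvent o ({u} : Set V)) (hu : u ≠ o) {y : V}
    (hy : y ≠ o) : ω ∈ openConn y o ↔ ω ∈ openConnIn {o}ᶜ u y := by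
  rw [show (ω ∈ openConn y o ↔ (openGraph ω).Reachable o y) from ⟨SimpleGraph.Reachable.symm, SimpleGraph.Reachable.symm⟩,
    th_reach_o_iff hσ hy]
  simp only [Set.mem_singleton_iff, exists_eq_left, hu, ne_eq, not_false_eq_true, true_and]

/-- Under `σ_{u,v}`: the glued-pair reachability. [cite: KozmaNitzan2024, Lemma 5 (p. 13)] -/
theorem th_kit_pair {ω : BondConfig V} {o u v : V} (hσ : ω ∈ starEvent o ({u, v} : Set V)) (huo : u ≠ o) (hvo : v ≠ o)
    {x y : V} (hx : x ≠ o) (hy : y ≠ o) :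
    ω ∈ openConn x y ↔
      ω ∈ openConnIn {o}ᶜ x y ∨
        ((ω ∈ openConnIn {o}ᶜ x u ∨ ω ∈ openConnIn {o}ᶜ x v) ∧ (ω ∈ openConnIn {o}ᶜ u y ∨ ω ∈ openConnIn {o}ᶜ v y)) :=
  th_reach_iff_pair hσ huo hvo hx hy

/-- Under `σ_{u,v}` (`u, v ≠ o`): `y ↔ o` iff `u ↔ y` or `v ↔ y` off `o`. [cite: KozmaNitzan2024, Lemma 5 (p. 13)] -/
theorem th_kit_pair_o {ω : BondConfig V} {o u v : V} (hσ : ω ∈ starEvent o ({u, v} : Set V)) (huo : u ≠ o) (hvo : v ≠ o)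
    {y : V} (hy : y ≠ o) : ω ∈ openConn y o ↔ ω ∈ openConnIn {o}ᶜ u y ∨ ω ∈ openConnIn {o}ᶜ v y := by
  rw [show (ω ∈ openConn y o ↔ (openGraph ω).Reachable o y) from ⟨SimpleGraph.Reachable.symm, SimpleGraph.Reachable.symm⟩,
    th_reach_o_iff hσ hy]
  constructor
  · rintro ⟨z, hz, -, hzy⟩
    rcases hz with rfl | rfl
    · exact Or.inl hzy
    · exact Or.inr hzy
  · rintro (h | h)
    · exact ⟨u, by simp, huo, h⟩
    · exact ⟨v, by simp, hvo, h⟩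

/-- Pull-back of `{x' ↔ y'}` along the restriction to `{o}ᶜ` (membership form). [folklore] -/
theorem th_kit_pre {o : V} (ω : BondConfig V) (x y : ({o}ᶜ : Set V)) :
    restrictConfig (Subtype.val : ({o}ᶜ : Set V) → V) ω ∈ openConn x y ↔ ω ∈ openConnIn {o}ᶜ (x : V) y :=
  reachable_restrictConfig_val_iff _ ω x y

variable [Fintype V]

/-- **Star slice of a measure**: if on `σ_B` the event `E` agrees with the pull-back of `E'` (an event off `o`), then
`μ(E ∩ σ_B) = μ(σ_B) · μ_{G∖o}(E')`. [cite: KozmaNitzan2024, proof of Thm. 4 (pp. 13–14)] -/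
theorem th_real_inter_star (w : Sym2 V → unitInterval) (o : V) (B : Set V) {E : Set (BondConfig V)}
    {E' : Set (BondConfig ({o}ᶜ : Set V))}
    (hE : ∀ ω ∈ starEvent o B, ω ∈ E ↔ restrictConfig (Subtype.val : ({o}ᶜ : Set V) → V) ω ∈ E') :
    (prodBernoulli w).real (E ∩ starEvent o B) =
      (prodBernoulli w).real (starEvent o B) * (prodBernoulli (w ∘ Sym2.map (Subtype.val : ({o}ᶜ : Set V) → V))).real E' := by
  have hset : E ∩ starEvent o B = starEvent o B ∩ restrictConfig (Subtype.val : ({o}ᶜ : Set V) → V) ⁻¹' E' := by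
    ext ω
    simp only [Set.mem_inter_iff, Set.mem_preimage]
    constructor
    · rintro ⟨h1, h2⟩
      exact ⟨h2, (hE ω h2).1 h1⟩
    · rintro ⟨h1, h2⟩
      exact ⟨(hE ω h1).2 h2, h1⟩
  rw [hset, real_starEvent_inter_preimage, real_preimage_restrictConfig_val]

omit [Fintype V] in
/-- Star slice of a measure, empty case: if `E` misses `σ_B` then `μ(E ∩ σ_B) = 0`. [folklore] -/
theorem th_real_inter_star_zero (w : Sym2 V → unitInterval) (o : V) (B : Set V) {E : Set (BondConfig V)}
    (hE : ∀ ω ∈ starEvent o B, ω ∉ E) : (prodBernoulli w).real (E ∩ starEvent o B) = 0 := by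
  have : E ∩ starEvent o B = ∅ := Set.eq_empty_iff_forall_notMem.2 fun ω ⟨h1, h2⟩ => hE ω h2 h1
  rw [this, measureReal_empty]

/-- `Σ_{B ⊆ {a,b}} f B = f ∅ + f {a} + f {b} + f {a,b}` for `a ≠ b`. [folklore] -/
theorem th_sum_powerset_pair {α : Type*} [DecidableEq α] {a b : α} (hab : a ≠ b) (f : Finset α → ℝ) :
    ∑ B ∈ ({a, b} : Finset α).powerset, f B = f ∅ + f {a} + f {b} + f {a, b} := by
  rw [Finset.sum_powerset_insert (by simpa using hab), ← Finset.insert_empty,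
    Finset.sum_powerset_insert (Finset.notMem_empty _), Finset.sum_powerset_insert (Finset.notMem_empty _),
    Finset.powerset_empty]
  simp only [Finset.sum_singleton, Finset.insert_empty]
  ring

/-- **Two-hair star decomposition**: if `o` has (positive-weight) pairs only to `a₁, a₂`, then
`μ(E) = μ(E ∩ σ_∅) + μ(E ∩ σ_{a₁}) + μ(E ∩ σ_{a₂}) + μ(E ∩ σ_{a₁,a₂})`. [cite: KozmaNitzan2024, proof of Thm. 4 (pp. 13–14)] -/
theorem th_real_eq_four (w : Sym2 V → unitInterval) {o a₁ a₂ : V} (h12 : a₁ ≠ a₂) (ho1 : o ≠ a₁) (ho2 : o ≠ a₂)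
    (hiso : ∀ u, u ≠ o → u ∉ ({a₁, a₂} : Finset V) → w s(o, u) = 0) (E : Set (BondConfig V)) :
    (prodBernoulli w).real E =
      (prodBernoulli w).real (E ∩ starEvent o (∅ : Set V)) + (prodBernoulli w).real (E ∩ starEvent o {a₁}) +
        (prodBernoulli w).real (E ∩ starEvent o {a₂}) + (prodBernoulli w).real (E ∩ starEvent o {a₁, a₂}) := by
  classical
  have ho : o ∉ ({a₁, a₂} : Finset V) := by simp [ho1, ho2]
  rw [real_eq_sum_inter_starEvent w {a₁, a₂} o ho hiso E, th_sum_powerset_pair h12]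
  simp only [Finset.coe_empty, Finset.coe_singleton, Finset.coe_insert]

end StarKit

end

end Summit.CriticalPhenomena.PercolationContinuityZ3.Theorems
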